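/-
Copyright: statement-level skeleton of a published paper (lit-balaban cell, Phase-2 proof seat p10, gen 2). No proof claims
beyond what the kernel checks below.
-/
import Mathlib
import Literature.MathematicalPhysics.QuantumFieldTheory.BalabanImbrieJaffe1984to88.BIJ85Tau2Kernel715

/-!
# `BalabanImbrieJaffe1984to88.BIJ85SigmaOnCurls325` — T. Bałaban, J. Imbrie, A. Jaffe, *Renormalization of the Higgs model:
minimizers, propagators and the stability of mean field theory*, Commun. Math. Phys. **97** (1985) 299–329
[BalabanImbrieJaffe1985]: Sect. 7.1 p. 325, the explicit formula for ⟨∂B, σ_k∂B⟩ = ⟨∂B, τ₂∂B⟩ on curls and its lower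
bound ε‖∂B‖² (*"This completes the proof of Theorem 7.1.1"*), PROVED for r15's momentum symbols

statement-level skeleton of published theorems with citation tags; proofs where landed; nothing here is a claim about
the Yang–Mills mass gap

PDF held: `paper:balaban1985-cmp97-bij-higgs-minimizers` (journal page = PDF page + 298).  Renders read as images: PDF pp.
24, 25, 27 (journal 322, 323, 325), poppler renders in the seat folder (`renders/c2-p024.png`, `c2-p025.png`, `c2-p027.png`).

CITATION HEADER (lean-in-tree rule).  Part of the lit-balaban TYPED SKELETON (HOME `run/shared/lean/pub/lit-balaban/`); WHAT IS
REPRODUCED: the last step of SKELETON row **C1.Eq7.1.28-7.1.31** (*"(7.1.28)–(7.1.31), end of proof of Thm 7.1.1"*,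
`HOME/lit-balaban-r15/ROWS-C1.md`, fold owner r15; p10 owns (7.1.28)–(7.1.31) of record, 01:53Z split), namely the
unnumbered display of p. 325 following (7.1.31).  THE PRINTED TEXT (p. 325 [PDF 27], verbatim): *"Next we consider the bound
on τ₂↾∂ℋ. But since τ₁∂ = 0, ⟨∂B, τ₂∂B⟩ = ⟨∂B, σ_k∂B⟩ = ⟨B, Δ_kB⟩, (7.1.31) using the definition (4.3.1) of Δ_k. An explicit
formula for Δ_k shows that ⟨∂B, σ_k∂B⟩ = ½ (Σ_ρ |∂_ρ^{(1)}|²/φ_ρ)^{−1} Σ_{μ,ν} |(∂B)_{μν}|²/(φ_μφ_ν). which is bounded below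
by ε‖∂B‖² (see also [6I, 8]). This completes the proof of Theorem 7.1.1."*  Inputs, all of r15's `BIJ85MomentumSymbols71`
(read-only here): τ₂ (7.1.15) `tau2Sym`, a_μ (7.1.16) `aSym`, φ_μ (7.1.10) `phiSym`, ∂^{(1)} (7.1.5) `dOne`, the curl
components `curlOne`, the pairing (7.1.3) `tensorInner`, σ_k = τ₁ + τ₂ (7.1.13) `Eq7113`, τ₁∂ = 0 (7.1.18) `tau1Sym_curl`;
and the generic algebra of the companion file `BIJ85Tau2Kernel715` (⟨∂B, τ₂∂B⟩ = |S|²·½N^{−1}Σ|(∂B)_{μν}|²/(φ_μφ_ν)).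

WHAT IS KERNEL-CHECKED (zero `sorry`, standard axioms):
 * `tau2Sym_eq_kernel` (`rfl`): r15's τ₂(p′) IS the generic kernel at a = a(p′), e = ∂^{(1)}(p′), φ = φ(p′);
 * `aPair_aSym_eq`: S(p′) = Σ_λ ā_λ(p′)∂_λ^{(1)}(p′) = Σ_l |u(p′+l)|² at generic momenta (Σ_λ|∂_λ|² = Δ (7.1.6) cancels the
   Δ^{−1} of (7.1.16)); hence `eq325_tau2_general` (the display with the factor (Σ_l|u(p′+l)|²)²) and **the printed display**
   `eq325_tau2` under the averaging normalisation Σ_l |u(p′+l)|² = 1 (`hQ`) — that normalisation is Q^e_kQ^{e*}_k = I in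
   momentum space, in the tree for the index set of [6I] as `Balaban1983to89.B5Prop11Leaves.sum_Ur_eq_one`; it is carried here
   as a hypothesis on r15's parametrised index set `lShifts d M` (T-note of `BIJ85MomentumSymbols71.lShifts`); and
   `eq325_sigma`: the same for σ_k(p′) through (7.1.13) + (7.1.18);
 * *"bounded below by ε‖∂B‖²"*: ε = γ₋/(2γ₊²) from a sandwich γ₋ ≤ Δ^{(1)}(p′)φ_μ(p′) ≤ γ₊, 0 < γ₋ — the [6I]-type bound (1.85)
   the print points to with *"(see also [6I, 8])"*, carried as a hypothesis (`lower_bound_eps` generic, `eq325_lower`).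
NOT reproduced: the operator Δ_k itself ((4.3.1), `BIJ85Sect4Statements`) and the derivation of (7.1.15) from [6I].
Unit `lit-balaban-p10` (gen 2), HOME as above.
-/

namespace Literature.MathematicalPhysics.QuantumFieldTheory.BalabanImbrieJaffe1984to88.BIJ85SigmaOnCurls325

open scoped BigOperators Real ComplexConjugate Matrix
open Finset Matrix
open Literature.MathematicalPhysics.QuantumFieldTheory.BalabanImbrieJaffe1984to88.BIJ85MomentumSymbols71
open Literature.MathematicalPhysics.QuantumFieldTheory.BalabanImbrieJaffe1984to88.BIJ85CurlComplement719
open Literature.MathematicalPhysics.QuantumFieldTheory.BalabanImbrieJaffe1984to88.BIJ85Tau2Kernel715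

noncomputable section

variable {d : ℕ}

/-! ## §1 r15's τ₂ is the generic kernel -/

/-- r15's τ₂(p′) (7.1.15) IS the generic kernel at a = a(p′) (7.1.16), e = ∂^{(1)}(p′), φ = φ(p′) (7.1.10).
[cite: BalabanImbrieJaffe1985, (7.1.15) p.323] -/
theorem tau2Sym_eq_kernel (η : ℝ) (M : ℕ) (p' : Fin d → ℝ) :
    tau2Sym η M p' = tau2Kernel (aSym η M p') (dOne p') (phiSym η M p') := by
  funext μ ν l κ
  rfl

/-! ## §2 r15's symbols: S(p′) = Σ_l |u(p′+l)|², and the printed display -/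

/-- The pairing S(p′) = Σ_λ ā_λ(p′)∂^{(1)}_λ(p′) is the real number Σ_λ |∂^{(1)}_λ(p′)|²·Σ_l |u/v_λ|²Δ^{−1}(p′+l).
[cite: BalabanImbrieJaffe1985, (7.1.16) p.323] -/
theorem aPair_aSym (η : ℝ) (M : ℕ) (p' : Fin d → ℝ) :
    aPair (aSym η M p') (dOne p') = ((∑ l, ‖dOne p' l‖ ^ 2 * ∑ m ∈ lShifts d M,
      ‖uSym η (shiftMom p' m) / vSym η (shiftMom p' m) l‖ ^ 2 * (lapSym η (shiftMom p' m))⁻¹ : ℝ) : ℂ) := by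
  unfold aPair aSym
  rw [Complex.ofReal_sum]
  refine Finset.sum_congr rfl fun l _ => ?_
  rw [← Complex.ofReal_sum, map_mul, Complex.conj_ofReal, mul_right_comm, Complex.conj_mul', Complex.ofReal_mul]
  push_cast
  ring

/-- kernel: |∂^{(1)}_λ(p′)|²·|u/v_λ|²(q) = |u(q)|²|∂_λ(q)|² at q = p′ + l with ∂_λ(q) ≠ 0 (v_λ(q) = ∂^{(1)}_λ(p′)/∂_λ(q); when
∂^{(1)}_λ(p′) = 0 both sides vanish since u = Π_μ v_μ). [cite: BalabanImbrieJaffe1985, (7.1.7) p.322] -/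
theorem norm_dOne_sq_mul (η : ℝ) (p' : Fin d → ℝ) (m : Fin d → ℤ) (l : Fin d)
    (hq : dSym η (shiftMom p' m) l ≠ 0) :
    ‖dOne p' l‖ ^ 2 * ‖uSym η (shiftMom p' m) / vSym η (shiftMom p' m) l‖ ^ 2
      = ‖uSym η (shiftMom p' m)‖ ^ 2 * ‖dSym η (shiftMom p' m) l‖ ^ 2 := by
  have hv : vSym η (shiftMom p' m) l = dOne p' l / dSym η (shiftMom p' m) l := by rw [vSym_eq, dOne_shiftMom]
  by_cases h0 : dOne p' l = 0
  · have hu : uSym η (shiftMom p' m) = 0 := by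
      rw [uSym_eq_prod]
      exact Finset.prod_eq_zero (Finset.mem_univ l) (by rw [hv, h0, zero_div])
    simp [h0, hu]
  · rw [hv, norm_div, norm_div, div_pow, div_pow]
    have h1 : ‖dOne p' l‖ ≠ 0 := norm_ne_zero_iff.mpr h0
    have h2 : ‖dSym η (shiftMom p' m) l‖ ≠ 0 := norm_ne_zero_iff.mpr hq
    field_simp

/-- **S(p′) = Σ_l |u(p′+l)|²** at generic momenta (no ∂_λ(p′+l) = 0, Δ(p′+l) ≠ 0): since Σ_λ |∂_λ|² = Δ (7.1.6), the Δ^{−1}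
of (7.1.16) cancels. [cite: BalabanImbrieJaffe1985, (7.1.16) p.323] -/
theorem aPair_aSym_eq (η : ℝ) (M : ℕ) (p' : Fin d → ℝ) (hΔ : ∀ m ∈ lShifts d M, lapSym η (shiftMom p' m) ≠ 0)
    (hq : ∀ m ∈ lShifts d M, ∀ i : Fin d, dSym η (shiftMom p' m) i ≠ 0) :
    aPair (aSym η M p') (dOne p') = ((∑ m ∈ lShifts d M, ‖uSym η (shiftMom p' m)‖ ^ 2 : ℝ) : ℂ) := by
  rw [aPair_aSym]
  congr 1
  simp_rw [Finset.mul_sum]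
  rw [Finset.sum_comm]
  refine Finset.sum_congr rfl fun m hm => ?_
  calc ∑ l, ‖dOne p' l‖ ^ 2 * (‖uSym η (shiftMom p' m) / vSym η (shiftMom p' m) l‖ ^ 2 *
          (lapSym η (shiftMom p' m))⁻¹)
      = (∑ l, ‖uSym η (shiftMom p' m)‖ ^ 2 * ‖dSym η (shiftMom p' m) l‖ ^ 2) * (lapSym η (shiftMom p' m))⁻¹ := by
        rw [Finset.sum_mul]
        exact Finset.sum_congr rfl fun l _ => by rw [← mul_assoc, norm_dOne_sq_mul η p' m l (hq m hm l)]
    _ = ‖uSym η (shiftMom p' m)‖ ^ 2 := by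
        rw [← Finset.mul_sum]
        change ‖uSym η (shiftMom p' m)‖ ^ 2 * lapSym η (shiftMom p' m) * (lapSym η (shiftMom p' m))⁻¹ = _
        rw [mul_assoc, mul_inv_cancel₀ (hΔ m hm), mul_one]

/-- **p. 325, ⟨∂B, τ₂∂B⟩ in general**: = (Σ_l |u(p′+l)|²)² · ½(Σ_ρ|∂_ρ^{(1)}|²/φ_ρ)^{−1}Σ_{μν}|(∂B)_{μν}|²/(φ_μφ_ν) on r15's
parametrised index set (φ(p′) > 0, p′ ∉ 2πℤ^d, generic momenta). [cite: BalabanImbrieJaffe1985, (7.1.31) p.325] -/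
theorem eq325_tau2_general (η : ℝ) (M : ℕ) (p' : Fin d → ℝ) (hφ : ∀ μ, 0 < phiSym η M p' μ)
    (hN : enn (dOne p') (phiSym η M p') ≠ 0) (hΔ : ∀ m ∈ lShifts d M, lapSym η (shiftMom p' m) ≠ 0)
    (hq : ∀ m ∈ lShifts d M, ∀ i : Fin d, dSym η (shiftMom p' m) i ≠ 0) (B : Fin d → ℂ) :
    tensorInner (curlOne p' B) (tau2Sym η M p') (curlOne p' B)
      = (((∑ m ∈ lShifts d M, ‖uSym η (shiftMom p' m)‖ ^ 2) ^ 2 *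
          (1 / 2 * (enn (dOne p') (phiSym η M p'))⁻¹ *
            ∑ μ, ∑ ν, ‖curlOne p' B μ ν‖ ^ 2 / (phiSym η M p' μ * phiSym η M p' ν)) : ℝ) : ℂ) := by
  rw [tau2Sym_eq_kernel, show curlOne p' B = curlP (dOne p') B from rfl, tau2Kernel_curl hφ hN,
    aPair_aSym_eq η M p' hΔ hq, Complex.norm_real, Real.norm_eq_abs, sq_abs]

/-- **p. 325 [PDF 27], the printed display for τ₂**, verbatim: *"An explicit formula for Δ_k shows that ⟨∂B, σ_k∂B⟩ =
½(Σ_ρ |∂_ρ^{(1)}|²/φ_ρ)^{−1} Σ_{μ,ν} |(∂B)_{μν}|²/(φ_μφ_ν)."* — PROVED for ⟨∂B, τ₂∂B⟩ (= ⟨∂B, σ_k∂B⟩ by (7.1.13) and τ₁∂ = 0,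
`eq325_sigma`) under the averaging normalisation Σ_l |u(p′+l)|² = 1 (`hQ`; Q^e_kQ^{e*}_k = I — in the tree for the index set of
[6I] as `Balaban1983to89.B5Prop11Leaves.sum_Ur_eq_one`), at a momentum p′ ∉ 2πℤ^d with φ(p′) > 0 and generic shifted momenta.
[cite: BalabanImbrieJaffe1985, (7.1.31) p.325] -/
theorem eq325_tau2 (η : ℝ) (M : ℕ) (p' : Fin d → ℝ) (hφ : ∀ μ, 0 < phiSym η M p' μ)
    (hN : enn (dOne p') (phiSym η M p') ≠ 0) (hΔ : ∀ m ∈ lShifts d M, lapSym η (shiftMom p' m) ≠ 0)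
    (hq : ∀ m ∈ lShifts d M, ∀ i : Fin d, dSym η (shiftMom p' m) i ≠ 0)
    (hQ : ∑ m ∈ lShifts d M, ‖uSym η (shiftMom p' m)‖ ^ 2 = 1) (B : Fin d → ℂ) :
    tensorInner (curlOne p' B) (tau2Sym η M p') (curlOne p' B)
      = ((1 / 2 * (∑ ρ, ‖dOne p' ρ‖ ^ 2 / phiSym η M p' ρ)⁻¹ *
          ∑ μ, ∑ ν, ‖curlOne p' B μ ν‖ ^ 2 / (phiSym η M p' μ * phiSym η M p' ν) : ℝ) : ℂ) := by
  rw [eq325_tau2_general η M p' hφ hN hΔ hq, hQ, one_pow, one_mul]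
  rfl

/-- kernel: the pairing (7.1.3) with the (λ, κ) sums innermost. [cite: BalabanImbrieJaffe1985, (7.1.3) p.321] -/
theorem tensorInner_eq_sum₂ (f : Fin d → Fin d → ℂ) (T : Fin d → Fin d → Fin d → Fin d → ℂ) (g : Fin d → Fin d → ℂ) :
    tensorInner f T g = ∑ μ, ∑ ν, conj (f μ ν) * ∑ l, ∑ κ, T μ ν l κ * g l κ := by
  simp only [tensorInner, Finset.mul_sum, mul_assoc]

/-- (7.1.18) as a form: ⟨∂B, τ₁∂B⟩ = 0 (r15's `tau1Sym_curl`). [cite: BalabanImbrieJaffe1985, (7.1.18) p.323] -/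
theorem tau1_form_curl (η : ℝ) (M : ℕ) (p' : Fin d → ℝ) (hp : ∀ i : Fin d, dOne p' i ≠ 0)
    (hΔ : ∀ m ∈ lShifts d M, lapSym η (shiftMom p' m) ≠ 0)
    (hq : ∀ m ∈ lShifts d M, ∀ i : Fin d, dSym η (shiftMom p' m) i ≠ 0) (B : Fin d → ℂ) :
    tensorInner (curlOne p' B) (tau1Sym η M p') (curlOne p' B) = 0 := by
  rw [tensorInner_eq_sum₂]
  exact Finset.sum_eq_zero fun μ _ => Finset.sum_eq_zero fun ν _ => by
    rw [tau1Sym_curl η M p' hp hΔ hq B μ ν, mul_zero]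

/-- **p. 325, the printed display for σ_k = τ₁ + τ₂** ((7.1.13) `Eq7113`; *"since τ₁∂ = 0, ⟨∂B, τ₂∂B⟩ = ⟨∂B, σ_k∂B⟩"*):
⟨∂B, σ_k(p′)∂B⟩ = ½(Σ_ρ|∂_ρ^{(1)}|²/φ_ρ)^{−1}Σ_{μν}|(∂B)_{μν}|²/(φ_μφ_ν), same hypotheses plus ∂^{(1)}(p′) componentwise ≠ 0
(r15's genericity for (7.1.18)). [cite: BalabanImbrieJaffe1985, (7.1.31) p.325] -/
theorem eq325_sigma (η : ℝ) (M : ℕ) (σ : (Fin d → ℝ) → Fin d → Fin d → Fin d → Fin d → ℂ) (hσ : Eq7113 η M σ)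
    (p' : Fin d → ℝ) (hp : ∀ i : Fin d, dOne p' i ≠ 0) (hφ : ∀ μ, 0 < phiSym η M p' μ)
    (hN : enn (dOne p') (phiSym η M p') ≠ 0) (hΔ : ∀ m ∈ lShifts d M, lapSym η (shiftMom p' m) ≠ 0)
    (hq : ∀ m ∈ lShifts d M, ∀ i : Fin d, dSym η (shiftMom p' m) i ≠ 0)
    (hQ : ∑ m ∈ lShifts d M, ‖uSym η (shiftMom p' m)‖ ^ 2 = 1) (B : Fin d → ℂ) :
    tensorInner (curlOne p' B) (σ p') (curlOne p' B)
      = ((1 / 2 * (∑ ρ, ‖dOne p' ρ‖ ^ 2 / phiSym η M p' ρ)⁻¹ *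
          ∑ μ, ∑ ν, ‖curlOne p' B μ ν‖ ^ 2 / (phiSym η M p' μ * phiSym η M p' ν) : ℝ) : ℂ) := by
  have hsplit : tensorInner (curlOne p' B) (σ p') (curlOne p' B)
      = tensorInner (curlOne p' B) (tau1Sym η M p') (curlOne p' B)
        + tensorInner (curlOne p' B) (tau2Sym η M p') (curlOne p' B) := by
    simp only [tensorInner, hσ p', ← Finset.sum_add_distrib]
    refine Finset.sum_congr rfl fun μ _ => Finset.sum_congr rfl fun ν _ => Finset.sum_congr rfl fun l _ =>
      Finset.sum_congr rfl fun κ _ => ?_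
    ring
  rw [hsplit, tau1_form_curl η M p' hp hΔ hq, zero_add, eq325_tau2 η M p' hφ hN hΔ hq hQ]

/-! ## §3 "bounded below by ε‖∂B‖²" -/

/-- **p. 325**, verbatim: *"which is bounded below by ε‖∂B‖² (see also [6I, 8])"* — PROVED with ε = γ₋/(2γ₊²) from a sandwich
γ₋ ≤ Δ^{(1)}φ_μ ≤ γ₊ (0 < γ₋, Δ^{(1)} = Σ_ρ|e_ρ|² > 0), the [6I] (1.85)-type bound on the averaged weights: for every two-form f,
γ₋/(2γ₊²)·Σ|f_{μν}|² ≤ ½N^{−1}Σ|f_{μν}|²/(φ_μφ_ν). [cite: BalabanImbrieJaffe1985, (7.1.31) p.325] -/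
theorem lower_bound_eps {e : Fin d → ℂ} {φ : Fin d → ℝ} {γm γp : ℝ} (hγm : 0 < γm) (hD : 0 < ∑ ρ, ‖e ρ‖ ^ 2)
    (hφ : ∀ μ, γm ≤ (∑ ρ, ‖e ρ‖ ^ 2) * φ μ ∧ (∑ ρ, ‖e ρ‖ ^ 2) * φ μ ≤ γp) (f : Fin d → Fin d → ℂ) :
    γm / (2 * γp ^ 2) * ∑ μ, ∑ ν, ‖f μ ν‖ ^ 2 ≤ 1 / 2 * (enn e φ)⁻¹ * ∑ μ, ∑ ν, ‖f μ ν‖ ^ 2 / (φ μ * φ ν) := by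
  set D : ℝ := ∑ ρ, ‖e ρ‖ ^ 2 with hDdef
  have hDne : D ≠ 0 := hD.ne'
  have hφpos : ∀ μ, 0 < φ μ := fun μ => by
    by_contra h
    have h' : φ μ ≤ 0 := not_lt.mp h
    have h1 := (hφ μ).1
    nlinarith [mul_nonpos_of_nonneg_of_nonpos hD.le h']
  have hne : (Finset.univ : Finset (Fin d)).Nonempty := by
    by_contra h
    rw [Finset.not_nonempty_iff_eq_empty] at h
    rw [hDdef, h, Finset.sum_empty] at hD
    exact lt_irrefl _ hD
  obtain ⟨ρ₀, _⟩ := hne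
  have hγp : 0 < γp := lt_of_lt_of_le hγm ((hφ ρ₀).1.trans (hφ ρ₀).2)
  have hinv : ∀ μ, D / γp ≤ (φ μ)⁻¹ ∧ (φ μ)⁻¹ ≤ D / γm := fun μ => by
    have hφμ := hφpos μ
    have hrepl : (φ μ)⁻¹ = D / (D * φ μ) := by field_simp
    rw [hrepl]
    exact ⟨div_le_div_of_nonneg_left hD.le (by positivity) (hφ μ).2,
      div_le_div_of_nonneg_left hD.le hγm (hφ μ).1⟩
  -- N = Σ|e_ρ|²/φ_ρ is sandwiched: D²/γ₊ ≤ N ≤ D²/γ₋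
  have hN_le : enn e φ ≤ D * (D / γm) := by
    unfold enn
    rw [Finset.sum_mul]
    exact Finset.sum_le_sum fun ρ _ => by
      rw [div_eq_mul_inv]
      exact mul_le_mul_of_nonneg_left (hinv ρ).2 (by positivity)
  have hN_ge : D * (D / γp) ≤ enn e φ := by
    unfold enn
    rw [Finset.sum_mul]
    exact Finset.sum_le_sum fun ρ _ => by
      rw [div_eq_mul_inv]
      exact mul_le_mul_of_nonneg_left (hinv ρ).1 (by positivity)
  have hNpos : 0 < enn e φ := lt_of_lt_of_le (by positivity) hN_ge
  have h1 : γm / (D * D) ≤ (enn e φ)⁻¹ := by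
    have : γm / (D * D) = (D * (D / γm))⁻¹ := by field_simp
    rw [this]
    exact inv_anti₀ hNpos hN_le
  rw [Finset.mul_sum, Finset.mul_sum]
  refine Finset.sum_le_sum fun μ _ => ?_
  rw [Finset.mul_sum, Finset.mul_sum]
  refine Finset.sum_le_sum fun ν _ => ?_
  have h2 : ‖f μ ν‖ ^ 2 * (D / γp * (D / γp)) ≤ ‖f μ ν‖ ^ 2 / (φ μ * φ ν) := by
    rw [div_eq_mul_inv (‖f μ ν‖ ^ 2), mul_inv]
    exact mul_le_mul_of_nonneg_left (mul_le_mul (hinv μ).1 (hinv ν).1 (div_nonneg hD.le hγp.le)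
      (inv_nonneg.mpr (hφpos μ).le)) (by positivity)
  calc γm / (2 * γp ^ 2) * ‖f μ ν‖ ^ 2
      = 1 / 2 * (γm / (D * D) * (‖f μ ν‖ ^ 2 * (D / γp * (D / γp)))) := by
        field_simp
    _ ≤ 1 / 2 * ((enn e φ)⁻¹ * (‖f μ ν‖ ^ 2 / (φ μ * φ ν))) :=
        mul_le_mul_of_nonneg_left (mul_le_mul h1 h2 (by positivity) (inv_nonneg.mpr hNpos.le)) (by norm_num)
    _ = 1 / 2 * (enn e φ)⁻¹ * (‖f μ ν‖ ^ 2 / (φ μ * φ ν)) := by ring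

/-- **p. 325, end of the proof of Theorem 7.1.1** at the symbol level: under the averaging normalisation and the [6I]-type
sandwich γ₋ ≤ Δ^{(1)}(p′)φ_μ(p′) ≤ γ₊, ε‖∂B‖² ≤ ⟨∂B, τ₂(p′)∂B⟩ with ε = γ₋/(2γ₊²) (a real number: `tau2_nonneg`).
[cite: BalabanImbrieJaffe1985, (7.1.31) p.325] -/
theorem eq325_lower (η : ℝ) (M : ℕ) (p' : Fin d → ℝ) {γm γp : ℝ} (hγm : 0 < γm)
    (hD : 0 < ∑ ρ, ‖dOne p' ρ‖ ^ 2)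
    (hφb : ∀ μ, γm ≤ (∑ ρ, ‖dOne p' ρ‖ ^ 2) * phiSym η M p' μ ∧ (∑ ρ, ‖dOne p' ρ‖ ^ 2) * phiSym η M p' μ ≤ γp)
    (hφ : ∀ μ, 0 < phiSym η M p' μ) (hN : enn (dOne p') (phiSym η M p') ≠ 0)
    (hΔ : ∀ m ∈ lShifts d M, lapSym η (shiftMom p' m) ≠ 0)
    (hq : ∀ m ∈ lShifts d M, ∀ i : Fin d, dSym η (shiftMom p' m) i ≠ 0)
    (hQ : ∑ m ∈ lShifts d M, ‖uSym η (shiftMom p' m)‖ ^ 2 = 1) (B : Fin d → ℂ) :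
    γm / (2 * γp ^ 2) * ∑ μ, ∑ ν, ‖curlOne p' B μ ν‖ ^ 2
      ≤ (tensorInner (curlOne p' B) (tau2Sym η M p') (curlOne p' B)).re := by
  rw [eq325_tau2 η M p' hφ hN hΔ hq hQ, Complex.ofReal_re]
  exact lower_bound_eps hγm hD hφb (curlOne p' B)

end

end Literature.MathematicalPhysics.QuantumFieldTheory.BalabanImbrieJaffe1984to88.BIJ85SigmaOnCurls325
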